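/-
Copyright: the b2b-balaban cell (near-miss cell 7), T⁴-continuum fan-out, lineage t4-ne7b-p1 (node U5c COUNT member).
Released under the licence of the surrounding project.
-/
import Summits.QuantumFields.BalabanUV.T4Continuum.Support.HistorySocket
import Summits.QuantumFields.BalabanUV.T4Continuum.Support.CountWitness

/-!
# The history socket is inhabited, non-vacuously: the witness history as a `LiveHistories` instance

Summits-side support leaf of the T⁴-continuum cell (rung (B)+1 on a FINITE torus only; NOT infinite volume, NOT the
mass gap, NOT the Clay statement; NOT a proof of the spine estimate NE7b).  Lineage `t4-ne7b-p1` (generation 21),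
node U5c.  [folklore] MODEL data over the lineage's OWN typed carrier; nothing is quoted from print, nothing printed is
asserted, nothing of Bałaban's is constructed; no `[cite:]` tag.

WHAT.  The witness of `Support/CountWitnessRun`∕`CountWitness` (constant run at the named threshold; one live history
per cutoff: two births, ONE MERGER, renewals at readiness; bad class `{true}` with price `price K > 0`) READ AS AN
INSTANCE of the ROUND-2 socket `HistorySocket.LiveHistories` — `live K c := {GK K}`, `cellOf := 0`: **`liveHistories_w`**
discharges ALL ELEVEN FIELDS (consistent ∕ wf ∕ pending ∕ cell_mem ∕ root_mem ∕ events_sub ∕ old ∕ slot_inj ∕ live_inj ∕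
price ∕ price′) from the witness lemmas, the price field being the identity `Fw K c · 1 ≤ ∏_{G ∈ {GK K}} shapeZ … G`
(`shapeZ … (GK K) = price K` by `rfl`).  An `example` + **`socket_nonvacuous`**: the socket route
`HistorySocket.relWeightBound_of_liveHistories` applied to it yields the same `RelWeightBound` conclusion shape as the
direct route `CountWitness.witness_relWeightBound` (hence an `example`, not a second declaration) — so (i) the socket's field list is JOINTLY SATISFIABLE with a merger
present and a positively priced bad class (not only by the empty-class instance of `HistorySocket` §4), and (ii) the
swarm `t4-ne7b-formalise-*` has a worked instance of every field to copy the shapes from.  §3 Sanity: the derived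
labelled price of the socket on the witness slot IS `price K`.

NOT DONE HERE.  Nothing of the walls (ID) G-ne7bp1g9-1, (E2)∕(R1) G-ne7bp1-1.  NE7b discharge: no date.

HONEST DEPENDENCY (cell): continuum YM on T⁴ ⇐ BetaPertH ∧ nine spine estimates (0/9 proved); BetaPertH ⇐ (D1) ∧ (D4)
∧ CAP+tail.  This file changes none of it.
-/

open Finset
open Literature.MathematicalPhysics.QuantumFieldTheory.Balaban1983to89
open T4PersistenceDictionary T4PersistentHistoryCount T4BankedInduction T4PrintedShapeBanking
open T4WeightBudget T4GlobalDenominator T4LiveClassFibration T4LiveStructureGas T4LiveGasToTerms T4RecordPriceSeam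
open T4PartnerMultiplicity
open Summit.QuantumFields.BalabanUV.T4Continuum.PlacementBatch
open Summit.QuantumFields.BalabanUV.T4Continuum.PlacementSkeleton
open Summit.QuantumFields.BalabanUV.T4Continuum.Crowding
open Summit.QuantumFields.BalabanUV.T4Continuum.CountThresholdUniform
open Summit.QuantumFields.BalabanUV.T4Continuum.CountWitnessRun
open Summit.QuantumFields.BalabanUV.T4Continuum.CountWitness
open Summit.QuantumFields.BalabanUV.T4Continuum.HistorySocket

namespace Summit.QuantumFields.BalabanUV.T4Continuum.HistorySocketWitness

noncomputable section

/-! ## §1 The witness data in socket form -/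

/-- the live families of the witness: the one witness genealogy, in every class [folklore] -/
def liveW (K : ℕ) (_c : Bool) : Finset (Gen PEv) := {GK K}

/-- the root cells of the witness: the cell `0` [folklore] -/
def cellW (_K : ℕ) (_G : Gen PEv) : ℕ := 0

/-- a genealogy live at cutoff `K` in the witness IS the witness genealogy [folklore] -/
theorem eq_GK_of_inLive {K : ℕ} {G : Gen PEv} (h : InLive 1 Badw liveW K G) : G = GK K := by
  obtain ⟨t, -, c, -, hG⟩ := h
  simpa [liveW] using hG

/-- the labelled shape of the witness genealogy IS the witness price (the same term) [folklore] -/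
theorem shapeZ_GK (K : ℕ) : shapeZ Cw 1 1 (1 / 2) 1 (fun _ _ => Rw) (fun _ _ => gw) K (GK K) = price K := rfl

/-! ## §2 The instance and the socket route -/

/-- **THE WITNESS IS A `LiveHistories` INSTANCE**: all eleven fields from the witness lemmas of `CountWitnessRun` ∕
`CountWitness` (`K₀ = 2`, `l₀ = 1`, constants `Cw`, `Kz = 1`, `p = 1`, `σ = 1∕2`, `Λ′ = 1`). [folklore] -/
theorem liveHistories_w :
    LiveHistories Cw 1 1 (1 / 2) 1 1 2 (fun _ _ => Rw) (fun _ _ => gw) Cellw Ew Bw (fun K => K / 2) Badw Fw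
      (fun _ _ => 1) Fw (fun _ _ => 1) liveW cellW where
  consistent K G hK h := by rw [eq_GK_of_inLive h]; exact consistent_GK hK
  wf K G _ h := by rw [eq_GK_of_inLive h]; exact wf_GK K
  pending K G _ h := by rw [eq_GK_of_inLive h]; exact lt_reach_GK K
  cell_mem K G _ _ := zero_mem_Cellw K _
  root_mem K G _ h := by rw [eq_GK_of_inLive h, root_GK, rootStep_GK]; exact b₀_mem_Bw K
  events_sub K G hK h := by rw [eq_GK_of_inLive h, root_GK, rootStep_GK]; exact QK_subset hK
  old K t _ hK c _ := ⟨GK K, by simp [liveW], by rw [rootStep_GK]; omega⟩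
  slot_inj K G G' _ h h' _ := by rw [eq_GK_of_inLive h, eq_GK_of_inLive h']
  live_inj K t _ _ := by simp [Badw]
  price K t _ _ c hc := by
    simp only [Badw, mem_singleton] at hc; subst hc
    rw [liveW, prod_singleton, shapeZ_GK]; simp [Fw]
  price' K t _ _ c hc := by
    simp only [Badw, mem_singleton] at hc; subst hc
    rw [liveW, prod_singleton, shapeZ_GK]; simp [Fw]

/- **THE SOCKET ROUTE ON THE WITNESS**: `HistorySocket.relWeightBound_of_liveHistories` applied to `liveHistories_w`
with the remaining (non-(ID)) binders discharged exactly as in `CountWitness.witness_relWeightBound` — the same conclusion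
(`BadT`, `Wbud`); an `example`, since the statement coincides with the landed direct witness. [folklore] -/
example : ∃ K₁, 2 ≤ K₁ ∧ RelWeightBound 1 Tw termA termA (BadT K₁) (Wbud K₁) :=
  relWeightBound_of_liveHistories thresholdOK_w (Kz := 1) (p := 1) (σ := 1 / 2) (ε := 1) (θ := 1) le_rfl zero_le_one
    (by norm_num) (by norm_num) one_pos one_pos Cellw zero_le_one (by norm_num) hcell_w Ew Bw hE_w (fun K => K / 2) hj_w
    (c := 1 / 2) (by norm_num) hfrac_w regen_w regen_w zero_le_one (fun _ _ => Rw) (fun _ _ => gw) (fun _ => 0)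
    (fun K _ => flowIneq27_w Cw.p₀ K) (fun K _ => flowIneq29_w K) (fun _ _ _ _ => isRj_w) (fun _ _ _ _ => one_le_log_gw)
    (fun _ _ => ir_w) hρbar_w hηbar_w hr_w zero_le_one hΛ1_w liveHistories_w

/-- **NON-VACUITY OF THE SOCKET ROUTE**: `HistorySocket.relWeightBound_of_liveHistories` APPLIED to the witness instance
yields, from some `K₁ ≥ 2` on, a `RelWeightBound` whose bad class is `{true}` with weight `price K > 0` and the certified
inequality `price K ≤ W K·(price K + 1)`. [folklore] -/
theorem socket_nonvacuous : ∃ (K₁ : ℕ) (W : ℕ → ℝ), 2 ≤ K₁ ∧ RelWeightBound 1 Tw termA termA (BadT K₁) W ∧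
    ∀ K, K₁ ≤ K → ∀ t : ℝ, |t| ≤ 1 → BadT K₁ K t = {true} ∧ 0 < price K ∧ price K ≤ W K * (price K + 1) := by
  obtain ⟨K₁, hK₁, hW⟩ : ∃ K₁, 2 ≤ K₁ ∧ RelWeightBound 1 Tw termA termA (BadT K₁) (Wbud K₁) :=
    relWeightBound_of_liveHistories thresholdOK_w (Kz := 1) (p := 1) (σ := 1 / 2) (ε := 1) (θ := 1) le_rfl zero_le_one
      (by norm_num) (by norm_num) one_pos one_pos Cellw zero_le_one (by norm_num) hcell_w Ew Bw hE_w (fun K => K / 2) hj_w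
      (c := 1 / 2) (by norm_num) hfrac_w regen_w regen_w zero_le_one (fun _ _ => Rw) (fun _ _ => gw) (fun _ => 0)
      (fun K _ => flowIneq27_w Cw.p₀ K) (fun K _ => flowIneq29_w K) (fun _ _ _ _ => isRj_w) (fun _ _ _ _ => one_le_log_gw)
      (fun _ _ => ir_w) hρbar_w hηbar_w hr_w zero_le_one hΛ1_w liveHistories_w
  refine ⟨K₁, Wbud K₁, hK₁, hW, fun K hK t ht => ⟨badT_eq hK t, price_pos K, ?_⟩⟩
  have h := hW.bad_left K t ht
  have hsum : ∑ τ ∈ BadT K₁ K t, termA K t τ = price K := by rw [badT_eq hK t]; simp [termA]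
  rwa [hsum, sum_termA] at h

/-! ## §3 Sanity -/

namespace Sanity

/-- the socket's DERIVED labelled price on the witness slot is the witness price [folklore] -/
example {K : ℕ} (hK : 2 ≤ K) :
    yOf Cw 1 1 (1 / 2) 1 1 (fun _ _ => Rw) (fun _ _ => gw) Badw liveW cellW K 0 0 b₀ (QK K) = price K := by
  have hin : InLive 1 Badw liveW K (GK K) := ⟨0, by norm_num, true, by simp [Badw], by simp [liveW]⟩
  have h := yOf_slotOf liveHistories_w hK hin
  rw [rootStep_GK, root_GK, shapeZ_GK] at h
  simpa [cellW, QK] using h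

/-- the socket's live slot family of the bad class is the witness slot [folklore] -/
example (K : ℕ) : strOf liveW cellW K true = {slotK K} := by
  simp [strOf, liveW, slotOf, cellW, slotK, QK, rootStep_GK, root_GK]

end Sanity

end

end Summit.QuantumFields.BalabanUV.T4Continuum.HistorySocketWitness
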